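import Literature.Computability.MetaComplexity.EFChainLaws
import Literature.Computability.MetaComplexity.EFSemantics
import HarnessLib

/-!
# Chains over an operation kit: semantics (square-and-multiply computes the power)

Layer E/7 of the `EF`-proof construction kit: what the chain template `OpKit.chainT` computes.
If the operation template computes a function `f x y N` of the numbers carried by its operands
(for a first operand in the domain `< N`), then along the chain `s_j`, `t_j` carry the values of
the recursion `s₀ = a`, `t₀ = e`, `s_{j+1} = f s_j s_j`, `t_{j+1} = b_j ? f t_j s_j : t_j`
(`OpKit.chain_sem`); for `f = (x · y) mod N` and the unit `1` this is `t_W = a ^ b mod N`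
(`OpKit.powChain_eq`).

## Sources

* H. Vollmer, *Introduction to Circuit Complexity* (Springer 1999), Def. 1.7, §1.2.
* D. E. Knuth, *The Art of Computer Programming* 2, §4.6.3 (binary method of exponentiation) —
  the recursion `a^(b mod 2^(j+1)) = a^(b mod 2^j) · (a^(2^j))^(b_j)`; folklore.
-/

namespace Literature.Computability.MetaComplexity

open _root_.Computability Complexity Complexity.PropForm Netlist

namespace ModAdd

namespace OpKit

variable {W : ℕ} (k : OpKit W)

/-- The values of `s_j` on the input values `inp`. [folklore] -/
def sB (inp : ℕ → Bool) : ℕ → ℕ → Bool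
  | 0, i => inp i
  | j + 1, i => wireVal k.chainT inp (k.offS j + k.resOff i)

/-- The values of `t_j` on the input values `inp`. [folklore] -/
def tB (inp : ℕ → Bool) (j i : ℕ) : Bool := wireVal k.chainT inp (k.tOff j i)

/-- The values of `p_j = res P_j`. [folklore] -/
def pB (inp : ℕ → Bool) (j i : ℕ) : Bool := wireVal k.chainT inp (k.offS j + k.T.length + k.resOff i)

/-- The semantic recursion of the chain for the operation `f` (with the modulus value `N`), the
unit value `ev`, first operand `a` and multiplier bits `b`: `(s_j, t_j)`. [folklore] -/
def csem (f : ℕ → ℕ → ℕ → ℕ) (N ev a : ℕ) (b : ℕ → Bool) : ℕ → ℕ × ℕ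
  | 0 => (a, ev)
  | j + 1 => let p := csem f N ev a b j; (f p.1 p.1 N, if b j then f p.2 p.1 N else p.2)

/-- `k.Computes NOK f`: on input values whose modulus value `N` satisfies `NOK N` and whose first
operand carries a number `< N`, the result wires of the operation template carry `f x y N`.
[folklore] -/
def Computes (NOK : ℕ → Prop) (f : ℕ → ℕ → ℕ → ℕ) : Prop :=
  ∀ inp : ℕ → Bool, NOK (wval (fun i => inp (2 * W + i)) W) → wval (fun i => inp i) W < wval (fun i => inp (2 * W + i)) W →
    wval (fun i => wireVal k.T inp (k.resOff i)) W = f (wval (fun i => inp i) W) (wval (fun i => inp (W + i)) W) (wval (fun i => inp (2 * W + i)) W)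

variable {k}

/-- Reading an input reference. [folklore] -/
theorem refVal_inl (inp w : ℕ → Bool) (i : ℕ) : refVal inp w (Sum.inl i) = inp i := rfl

/-- Reading a gate reference. [folklore] -/
theorem refVal_inr (inp w : ℕ → Bool) (g : ℕ) : refVal inp w (Sum.inr g) = w g := rfl

/-- The sources of `s_j` carry `s_j`. [folklore] -/
theorem refVal_sSrc (inp : ℕ → Bool) (j i : ℕ) : refVal inp (wireVal k.chainT inp) (k.sSrc j i) = k.sB inp j i := by
  cases j <;> rfl

/-- The sources of `t_j` carry `t_j`. [folklore] -/
theorem refVal_tSrc (inp : ℕ → Bool) (j i : ℕ) : refVal inp (wireVal k.chainT inp) (k.tSrc j i) = k.tB inp j i := by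
  cases j <;> rfl

/-- **What the chain computes.** If the operation template computes `f` on first operands in the
domain and `f` preserves the domain, then `s_j`, `t_j` carry the semantic recursion `csem`
(for `a, e < N`). [cite: Vollmer1999, Def. 1.7] -/
theorem chain_sem {NOK : ℕ → Prop} {f : ℕ → ℕ → ℕ → ℕ} (hT : k.Computes NOK f) (inp : ℕ → Bool) (hNOK : NOK (wval (fun i => inp (2 * W + i)) W))
    (hf : ∀ x y, x < wval (fun i => inp (2 * W + i)) W → f x y (wval (fun i => inp (2 * W + i)) W) < wval (fun i => inp (2 * W + i)) W)
    (ha : wval (fun i => inp i) W < wval (fun i => inp (2 * W + i)) W) (he : wval k.e W < wval (fun i => inp (2 * W + i)) W) :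
    ∀ j ≤ W, wval (k.sB inp j) W = (csem f (wval (fun i => inp (2 * W + i)) W) (wval k.e W) (wval (fun i => inp i) W) (fun j => inp (W + j)) j).1 ∧
      wval (k.tB inp j) W = (csem f (wval (fun i => inp (2 * W + i)) W) (wval k.e W) (wval (fun i => inp i) W) (fun j => inp (W + j)) j).2 ∧
      (csem f (wval (fun i => inp (2 * W + i)) W) (wval k.e W) (wval (fun i => inp i) W) (fun j => inp (W + j)) j).1 < wval (fun i => inp (2 * W + i)) W ∧
      (csem f (wval (fun i => inp (2 * W + i)) W) (wval k.e W) (wval (fun i => inp i) W) (fun j => inp (W + j)) j).2 < wval (fun i => inp (2 * W + i)) W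
  | 0, _ => by
    refine ⟨rfl, ?_, ha, he⟩
    -- `t_0` are the constants `e`
    refine wval_congr fun i hi => ?_
    show wireVal k.chainT inp (k.tOff 0 i) = k.e i
    have h := wireVal_layout k.pieces k.piece_ok inp (k := 0) (N := 3 * W + 2) (by omega) (j := i) (by simpa [pieces] using hi)
    rw [offset_zero, Nat.zero_add] at h
    simp only [tOff, chainT]
    rw [h]
    show wireVal (constRow k.e W) _ i = _
    rw [wireVal_eq (wf_constRow _ _ 0) _ (by simpa using hi), getElem_constRow]
    rfl
  | j + 1, hj => by
    obtain ⟨ihs, iht, hs, ht⟩ := chain_sem hT inp hNOK hf ha he j (by omega)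
    have hjW : j < W := by omega
    set N := wval (fun i => inp (2 * W + i)) W with hN
    set c := csem f N (wval k.e W) (wval (fun i => inp i) W) (fun j => inp (W + j)) j with hc
    -- the occurrence `S_j` on its input values
    have hS : ∀ g < k.T.length, wireVal k.chainT inp (k.offS j + g) = wireVal k.T (fun q => refVal inp (wireVal k.chainT inp) (k.wS j q)) g := by
      intro g hg
      have h := wireVal_layout k.pieces k.piece_ok inp (k := 3 * j + 0 + 1) (N := 3 * W + 2) (by omega) (j := g)
        (by rw [k.pieces_blk hjW 0 (by norm_num)]; exact hg)
      rw [Nat.add_zero, k.offset_S hjW.le] at h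
      rw [chainT, h, k.pieces_blk hjW 0 (by norm_num)]; rfl
    have hSx : wval (fun i => refVal inp (wireVal k.chainT inp) (k.wS j i)) W = c.1 := by
      rw [← ihs]; exact wval_congr fun i hi => by rw [wS, if_pos hi, refVal_sSrc inp j i]
    have hSy : wval (fun i => refVal inp (wireVal k.chainT inp) (k.wS j (W + i))) W = c.1 := by
      rw [← ihs]; exact wval_congr fun i hi => by unfold wS; rw [if_neg (by omega), if_pos (by omega), Nat.add_sub_cancel_left, refVal_sSrc inp j i]
    have hSn : wval (fun i => refVal inp (wireVal k.chainT inp) (k.wS j (2 * W + i))) W = N := by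
      refine wval_congr fun i hi => ?_; unfold wS; rw [if_neg (by omega), if_neg (by omega)]; rfl
    have hs' : wval (k.sB inp (j + 1)) W = f c.1 c.1 N := by
      have h := hT (fun q => refVal inp (wireVal k.chainT inp) (k.wS j q)) (by rw [hSn]; exact hNOK) (by rw [hSx, hSn]; exact hs)
      rw [hSx, hSy, hSn] at h
      rw [← h]; exact wval_congr fun i hi => hS _ (k.resOff_lt i hi)
    -- the occurrence `P_j` on its input values
    have hP : ∀ g < k.T.length, wireVal k.chainT inp (k.offS j + k.T.length + g) = wireVal k.T (fun q => refVal inp (wireVal k.chainT inp) (k.wP j q)) g := by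
      intro g hg
      have h := wireVal_layout k.pieces k.piece_ok inp (k := 3 * j + 1 + 1) (N := 3 * W + 2) (by omega) (j := g)
        (by rw [k.pieces_blk hjW 1 (by norm_num)]; exact hg)
      rw [k.offset_P hjW] at h
      rw [chainT, h, k.pieces_blk hjW 1 (by norm_num)]; rfl
    have hPx : wval (fun i => refVal inp (wireVal k.chainT inp) (k.wP j i)) W = c.2 := by
      rw [← iht]; exact wval_congr fun i hi => by rw [wP, if_pos hi, refVal_tSrc]
    have hPy : wval (fun i => refVal inp (wireVal k.chainT inp) (k.wP j (W + i))) W = c.1 := by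
      rw [← ihs]; exact wval_congr fun i hi => by unfold wP; rw [if_neg (by omega), if_pos (by omega), Nat.add_sub_cancel_left, refVal_sSrc inp j i]
    have hPn : wval (fun i => refVal inp (wireVal k.chainT inp) (k.wP j (2 * W + i))) W = N := by
      refine wval_congr fun i hi => ?_; unfold wP; rw [if_neg (by omega), if_neg (by omega)]; rfl
    have hp' : wval (k.pB inp j) W = f c.2 c.1 N := by
      have h := hT (fun q => refVal inp (wireVal k.chainT inp) (k.wP j q)) (by rw [hPn]; exact hNOK) (by rw [hPx, hPn]; exact ht)
      rw [hPx, hPy, hPn] at h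
      rw [← h]; exact wval_congr fun i hi => hP _ (k.resOff_lt i hi)
    -- the multiplexers
    have ht' : wval (k.tB inp (j + 1)) W = if inp (W + j) then f c.2 c.1 N else c.2 := by
      have hm : ∀ i < W, k.tB inp (j + 1) i = ((inp (W + j) && k.pB inp j i) || (!inp (W + j) && k.tB inp j i)) := by
        intro i hi
        have hlen : i < (k.pieces (3 * j + 2 + 1)).T.length := by rw [k.pieces_blk hjW 2 (by norm_num), length_chPiece, if_neg (by norm_num)]; exact hi
        have h := wireVal_layout k.pieces k.piece_ok inp (k := 3 * j + 2 + 1) (N := 3 * W + 2) (by omega) (j := i) hlen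
        rw [k.offset_M hjW] at h
        have hT' : (k.pieces (3 * j + 2 + 1)).T = muxRow W := by rw [k.pieces_blk hjW 2 (by norm_num)]; rfl
        have hw' : (k.pieces (3 * j + 2 + 1)).wire = k.wM j := by rw [k.pieces_blk hjW 2 (by norm_num)]; rfl
        show wireVal k.chainT inp (k.tOff (j + 1) i) = _
        simp only [tOff, chainT]
        rw [h, hw', wireVal_congr (nIn := 2 * W + 1) (g := fun q => refVal inp (wireVal (layout k.pieces (3 * W + 2)) inp) (k.wM j q))
          (by rw [hT']; exact wf_muxRow W) (fun _ _ => rfl) hlen]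
        rw [show wireVal (k.pieces (3 * j + 2 + 1)).T = wireVal (muxRow W) by rw [hT'], wireVal_eq (wf_muxRow W) _ (by simpa using hi), getElem_muxRow]
        have w0 : k.wM j 0 = Sum.inl (W + j) := by simp [wM]
        have w1 : k.wM j (1 + i) = Sum.inr (k.offS j + k.T.length + k.resOff i) := by unfold wM; rw [if_neg (by omega), if_pos (by omega), show 1 + i - 1 = i by omega]
        have w2 : k.wM j (1 + W + i) = k.tSrc j i := by unfold wM; rw [if_neg (by omega), if_neg (by omega), show 1 + W + i - (W + 1) = i by omega]
        simp only [Kind.fn, argVal, List.getElem?_cons_zero, List.getElem?_cons_succ, refVal_inl, w0, w1, w2, refVal_inr]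
        show (inp (W + j) && k.pB inp j i || !inp (W + j) && refVal inp (wireVal k.chainT inp) (k.tSrc j i)) = _
        rw [refVal_tSrc]
      split_ifs with hb
      · rw [← hp']; exact wval_congr fun i hi => by rw [hm i hi, hb]; simp
      · rw [← iht]; exact wval_congr fun i hi => by rw [hm i hi, Bool.eq_false_iff.2 hb]; simp
    refine ⟨?_, ?_, ?_, ?_⟩
    · rw [hs']; rfl
    · rw [ht']; simp only [csem]; rfl
    · exact hf _ _ hs
    · show (if inp (W + j) then f c.2 c.1 N else c.2) < N
      split_ifs
      · exact hf _ _ ht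
      · exact ht

/-! ### Square-and-multiply -/

/-- **The binary method computes the power**: for `f x y N = x · y mod N`, unit value `1` and
`N > 1`, the recursion gives `s_j = a^(2^j) mod N` and `t_j = a^(b mod 2^j) mod N`.
[cite: Vollmer1999, §1.2] -/
theorem csem_pow (N a : ℕ) (hN : 1 < N) (ha : a < N) (b : ℕ → Bool) : ∀ j,
    csem (fun x y N => x * y % N) N 1 a b j = (a ^ 2 ^ j % N, a ^ (wval b j) % N)
  | 0 => by simp [csem, Nat.mod_eq_of_lt hN, Nat.mod_eq_of_lt ha]
  | j + 1 => by
    rw [csem, csem_pow N a hN ha b j]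
    simp only
    congr 1
    · rw [← Nat.mul_mod, ← pow_add, ← Nat.two_mul, ← pow_succ']
    · rw [wval_succ]
      cases b j
      · simp
      · simp only [ite_true, Bool.toNat_true, Nat.one_mul]
        rw [← Nat.mul_mod, ← pow_add]

/-- **The chain over a kit computing modular multiplication computes the modular power**
(for a unit pattern carrying `1`, `a < N`, `1 < N`): `t_W` carries `a ^ b mod N`.
[cite: Vollmer1999, §1.2] -/
theorem powChain_eq {NOK : ℕ → Prop} (hT : k.Computes NOK fun x y N => x * y % N) (he1 : ∀ i < W, k.e i = decide (i = 0)) (inp : ℕ → Bool)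
    (hNOK : NOK (wval (fun i => inp (2 * W + i)) W)) (hN : 1 < wval (fun i => inp (2 * W + i)) W) (ha : wval (fun i => inp i) W < wval (fun i => inp (2 * W + i)) W) :
    wval (k.tB inp W) W = wval (fun i => inp i) W ^ wval (fun i => inp (W + i)) W % wval (fun i => inp (2 * W + i)) W := by
  have hW : 0 < W := by
    by_contra h
    have hW0 : W = 0 := by omega
    subst hW0
    simp at hN
  have he : wval k.e W = 1 := wval_onehot hW he1
  have h := (chain_sem hT inp hNOK (fun x y _ => Nat.mod_lt _ (by omega)) ha (by rw [he]; exact hN) W le_rfl).2.1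
  rw [he, csem_pow _ _ hN ha] at h
  exact h

end OpKit

end ModAdd

end Literature.Computability.MetaComplexity
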